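import Literature.MathematicalPhysics.QuantumFieldTheory.Balaban1983to89.B4Eq19LatticeOperators
import HarnessLib

/-!
# Route `UnitScaleTilt`, crux K1 «MinimiserStabilityRegPr» (stmt-QuantumFields-19200) — route-R E′ (A′), (N06) coercivity row `hCo`, LANE II «DIVERGENCE RECOVERY»
# (★★OWNER g29 WORD 2026-08-29T05:46Z «px4: GO-A — (B0) + (B1)-FLAT»; LOCATE #60 brick (B1), part 1∕2): **THE FLAT WEITZENBÖCK IDENTITY ON `ℤᵈ` FOR A FINITELY
# SUPPORTED ONE-FORM** — `Σ Σ_μ Σ_ν (∂_ν g_μ)² = ½·Σ Σ_μ Σ_ν (∂_μ g_ν − ∂_ν g_μ)² + Σ (∂*g)²` ([Balaban1984PropagatorsI] (1.21), ordered pairs counted twice hence the `½`)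

Cell `ym3-torus`, width seat `ym3-torus-px4` (gen 7).  THEOREMS ONLY (0 `def`, 0 `sorry`); `--supports stmt-QuantumFields-19200 --as helper`, count-neutral; consumer-independent.
YM₃ on T³ is a ladder rung (R3), not d = 4, not infinite volume, not the Clay problem; nothing here claims [Balaban1985BackgroundPropagators] Thm 3.3 ∕ 3.11, `hCo`, `hN06`, E′, EX, H, the crux
or the gap.  The torus version of this identity is the tree's ✓`Prop7FlatHodgeCoercivity.sum_grad_sq_eq_curl_add_diverg`; this is the `ℤᵈ` version with finite support (needed for BOX statements,
part 2∕2 `…LatticeBoxFriedrichs`).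

LETTERS (lit ✓`B4Eq19LatticeOperators`): `Zd d = Fin d → ℤ`, `unitVec μ = e_μ`, `box z r = Q_r(z)`, `fdiff μ u y = u(y + e_μ) − u(y)`, `dvg g y = Σ_μ (g(y − e_μ, μ) − g(y, μ))`; a one-form is
`g : Zd d → Fin d → ℝ`, `g y μ` = the value on the edge `⟨y, y + e_μ⟩`; its curl on the plaquette `(y; μ, ν)` is `fdiff μ (g · ν) y − fdiff ν (g · μ) y = ∂_μ g_ν − ∂_ν g_μ`.

WHAT IS PROVED (ns `…Theorems.Prop7LatticeWeitzenbockZd`): `sum_box_shift_sub` (one shift `Σ_{Q_R} A(y − e_μ)·B(y) = Σ_{Q_R} A(y)·B(y + e_μ)`), support helpers,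
★`sum_fdiff_mul_fdiff_eq_sum_bdiff_mul_bdiff` (the pair identity `Σ ∂_μg_ν·∂_νg_μ = Σ ∂⁻_μg_μ·∂⁻_νg_ν`, four shifts), ★★`sum_grad_sq_eq_half_curl_sq_add_dvg_sq` (the identity, for `g`
supported in `Q_{R−2}(z)`, all sums over `Q_R(z)`).
HONEST SCOPE.  Flat lattice calculus ([folklore]); nothing of print asserted; rung R3, not Clay; YM gap NOT proved.

References: T. Bałaban, CMP **95** (1984) 17–40 [Balaban1984PropagatorsI] ((1.21) p.21); M. Giaquinta, *Multiple integrals in the calculus of variations and nonlinear elliptic systems* (1983)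
[Giaquinta1984] (Ch. III §1).
-/

set_option autoImplicit false

noncomputable section

open scoped BigOperators
open Finset

namespace Summit.QuantumFields.YangMills.Theorems.Prop7LatticeWeitzenbockZd

open Literature.MathematicalPhysics.QuantumFieldTheory.Balaban1983to89.B4Eq19LatticeOperators

variable {d : ℕ}

/-! ## §1 Shifts and the pair identity -/

/-- **One shift**: if `y ↦ A(y − e_μ)·B(y)` vanishes off `Q_{R−1}(z)`, then `Σ_{Q_R(z)} A(y − e_μ)·B(y) = Σ_{Q_R(z)} A(y)·B(y + e_μ)`. [folklore]
[cite: Giaquinta1984, Ch. III §1 p.64] -/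
theorem sum_box_shift_sub (A B : Zd d → ℝ) (z : Zd d) (R : ℤ) (μ : Fin d)
    (hAB : ∀ y ∉ box z (R - 1), A (y - unitVec μ) * B y = 0) :
    ∑ y ∈ box z R, A (y - unitVec μ) * B y = ∑ y ∈ box z R, A y * B (y + unitVec μ) := by
  have h := sum_box_shift_of_support (F := fun y => A (y - unitVec μ) * B y) (z := z) (R := R) hAB (unitVec μ) (abs_unitVec_apply_le μ)
  simp only [add_sub_cancel_right] at h
  exact h.symm

/-- A function vanishing off `Q_{R−2}` vanishes at `y − e_μ` for `y ∉ Q_{R−1}`. [folklore] [cite: Giaquinta1984, Ch. III §1 p.64] -/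
theorem apply_sub_eq_zero_of_support {A : Zd d → ℝ} {z : Zd d} {R : ℤ} (hA : ∀ y ∉ box z (R - 2), A y = 0) (μ : Fin d) (y : Zd d)
    (hy : y ∉ box z (R - 1)) : A (y - unitVec μ) = 0 := by
  have hy' : y ∉ box z (R - 2 + 1) := by rwa [show R - 2 + 1 = R - 1 by ring]
  exact hA _ (sub_unitVec_not_mem_box hy' μ)

/-- A function vanishing off `Q_{R−2}` vanishes off `Q_{R−1}`. [folklore] [cite: Giaquinta1984, Ch. III §1 p.64] -/
theorem apply_eq_zero_of_support {A : Zd d → ℝ} {z : Zd d} {R : ℤ} (hA : ∀ y ∉ box z (R - 2), A y = 0) (y : Zd d)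
    (hy : y ∉ box z (R - 1)) : A y = 0 :=
  hA y fun h => hy (box_mono z (by linarith) h)

/-- ★ **THE PAIR IDENTITY** (discrete `∫ ∂_μg_ν·∂_νg_μ = ∫ ∂_μg_μ·∂_νg_ν`, integration by parts twice; valid also for `μ = ν`): for a one-form `g` supported in `Q_{R−2}(z)`,
`Σ_{Q_R} (g(y+e_μ,ν) − g(y,ν))·(g(y+e_ν,μ) − g(y,μ)) = Σ_{Q_R} (g(y−e_μ,μ) − g(y,μ))·(g(y−e_ν,ν) − g(y,ν))`. [folklore] [cite: Balaban1984PropagatorsI, (1.21) p.21] -/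
theorem sum_fdiff_mul_fdiff_eq_sum_bdiff_mul_bdiff (g : Zd d → Fin d → ℝ) (z : Zd d) (R : ℤ)
    (hg : ∀ y ∉ box z (R - 2), ∀ μ, g y μ = 0) (μ ν : Fin d) :
    ∑ y ∈ box z R, fdiff μ (fun x => g x ν) y * fdiff ν (fun x => g x μ) y
      = ∑ y ∈ box z R, (g (y - unitVec μ) μ - g y μ) * (g (y - unitVec ν) ν - g y ν) := by
  have hgμ : ∀ y ∉ box z (R - 2), g y μ = 0 := fun y hy => hg y hy μ
  have hgν : ∀ y ∉ box z (R - 2), g y ν = 0 := fun y hy => hg y hy ν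
  -- T2: `Σ g(y−e_μ,μ)·g(y,ν) = Σ g(y,μ)·g(y+e_μ,ν)`
  have T2 : ∑ y ∈ box z R, g (y - unitVec μ) μ * g y ν = ∑ y ∈ box z R, g y μ * g (y + unitVec μ) ν :=
    sum_box_shift_sub (fun x => g x μ) (fun x => g x ν) z R μ
      (fun y hy => by rw [apply_sub_eq_zero_of_support hgμ μ y hy, zero_mul])
  -- T3: `Σ g(y,μ)·g(y−e_ν,ν) = Σ g(y+e_ν,μ)·g(y,ν)`
  have T3 : ∑ y ∈ box z R, g y μ * g (y - unitVec ν) ν = ∑ y ∈ box z R, g (y + unitVec ν) μ * g y ν := by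
    have h := sum_box_shift_sub (fun x => g x ν) (fun x => g x μ) z R ν
      (fun y hy => by rw [apply_sub_eq_zero_of_support hgν ν y hy, zero_mul])
    calc ∑ y ∈ box z R, g y μ * g (y - unitVec ν) ν = ∑ y ∈ box z R, g (y - unitVec ν) ν * g y μ :=
          Finset.sum_congr rfl fun y _ => mul_comm _ _
      _ = ∑ y ∈ box z R, g y ν * g (y + unitVec ν) μ := h
      _ = ∑ y ∈ box z R, g (y + unitVec ν) μ * g y ν := Finset.sum_congr rfl fun y _ => mul_comm _ _
  -- T1: `Σ g(y−e_μ,μ)·g(y−e_ν,ν) = Σ g(y+e_ν,μ)·g(y+e_μ,ν)` (two shifts)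
  have T1 : ∑ y ∈ box z R, g (y - unitVec μ) μ * g (y - unitVec ν) ν = ∑ y ∈ box z R, g (y + unitVec ν) μ * g (y + unitVec μ) ν := by
    have s1 := sum_box_shift_sub (fun x => g x μ) (fun y => g (y - unitVec ν) ν) z R μ
      (fun y hy => by rw [apply_sub_eq_zero_of_support hgμ μ y hy, zero_mul])
    have s2 := sum_box_shift_sub (fun w => g (w + unitVec μ) ν) (fun x => g x μ) z R ν
      (fun y hy => by rw [apply_eq_zero_of_support hgμ y hy, mul_zero])
    calc ∑ y ∈ box z R, g (y - unitVec μ) μ * g (y - unitVec ν) ν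
        = ∑ y ∈ box z R, g y μ * g (y + unitVec μ - unitVec ν) ν := s1
      _ = ∑ y ∈ box z R, g (y - unitVec ν + unitVec μ) ν * g y μ :=
          Finset.sum_congr rfl fun y _ => by rw [mul_comm, add_sub_right_comm]
      _ = ∑ y ∈ box z R, g (y + unitVec μ) ν * g (y + unitVec ν) μ := s2
      _ = ∑ y ∈ box z R, g (y + unitVec ν) μ * g (y + unitVec μ) ν := Finset.sum_congr rfl fun y _ => mul_comm _ _
  -- expand both sides
  have eL : ∀ y, fdiff μ (fun x => g x ν) y * fdiff ν (fun x => g x μ) y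
      = g (y + unitVec ν) μ * g (y + unitVec μ) ν - g y μ * g (y + unitVec μ) ν - g (y + unitVec ν) μ * g y ν + g y μ * g y ν := by
    intro y; simp only [fdiff]; ring
  have eR : ∀ y, (g (y - unitVec μ) μ - g y μ) * (g (y - unitVec ν) ν - g y ν)
      = g (y - unitVec μ) μ * g (y - unitVec ν) ν - g (y - unitVec μ) μ * g y ν - g y μ * g (y - unitVec ν) ν + g y μ * g y ν := by
    intro y; ring
  simp only [eL, eR, Finset.sum_add_distrib, Finset.sum_sub_distrib, T1, T2, T3]

/-! ## §2 The Weitzenböck identity on `ℤᵈ` for a finitely supported one-form -/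

/-- ★★ **FLAT WEITZENBÖCK ON `ℤᵈ`** ([Balaban1984PropagatorsI] (1.21) `Σ|∇A|² = Σ|∂A|² + Σ|∂*A|²`, here with finite support and ORDERED pairs in the curl sum, hence the `½`):
for a one-form `g` supported in `Q_{R−2}(z)`,  `Σ_{Q_R} Σ_μ Σ_ν (∂_ν g_μ)² = ½·Σ_{Q_R} Σ_μ Σ_ν (∂_μ g_ν − ∂_ν g_μ)² + Σ_{Q_R} (∂*g)²`. [cite: Balaban1984PropagatorsI, (1.21) p.21] -/
theorem sum_grad_sq_eq_half_curl_sq_add_dvg_sq (g : Zd d → Fin d → ℝ) (z : Zd d) (R : ℤ)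
    (hg : ∀ y ∉ box z (R - 2), ∀ μ, g y μ = 0) :
    ∑ y ∈ box z R, ∑ μ, ∑ ν, fdiff ν (fun x => g x μ) y ^ 2
      = (1 / 2) * ∑ y ∈ box z R, ∑ μ, ∑ ν, (fdiff μ (fun x => g x ν) y - fdiff ν (fun x => g x μ) y) ^ 2
        + ∑ y ∈ box z R, dvg g y ^ 2 := by
  -- X := Σ_y Σ_μ Σ_ν ∂_μg_ν·∂_νg_μ ; Y := Σ_y Σ_μ Σ_ν ∂⁻_μg_μ·∂⁻_νg_ν ; X = Y by the pair identity
  have hXY : ∑ y ∈ box z R, ∑ μ, ∑ ν, fdiff μ (fun x => g x ν) y * fdiff ν (fun x => g x μ) y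
      = ∑ y ∈ box z R, ∑ μ, ∑ ν, (g (y - unitVec μ) μ - g y μ) * (g (y - unitVec ν) ν - g y ν) := by
    rw [Finset.sum_comm]
    conv_rhs => rw [Finset.sum_comm]
    refine Finset.sum_congr rfl fun μ _ => ?_
    rw [Finset.sum_comm]
    conv_rhs => rw [Finset.sum_comm]
    refine Finset.sum_congr rfl fun ν _ => ?_
    exact sum_fdiff_mul_fdiff_eq_sum_bdiff_mul_bdiff g z R hg μ ν
  -- the divergence square as a double sum
  have hD : ∀ y, dvg g y ^ 2 = ∑ μ, ∑ ν, (g (y - unitVec μ) μ - g y μ) * (g (y - unitVec ν) ν - g y ν) := by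
    intro y
    rw [dvg_apply, sq, Finset.sum_mul_sum]
  -- the symmetric square
  have hG : ∑ y ∈ box z R, ∑ μ, ∑ ν, fdiff μ (fun x => g x ν) y ^ 2 = ∑ y ∈ box z R, ∑ μ, ∑ ν, fdiff ν (fun x => g x μ) y ^ 2 :=
    Finset.sum_congr rfl fun y _ => Finset.sum_comm
  have hC : ∀ y, ∑ μ, ∑ ν, (fdiff μ (fun x => g x ν) y - fdiff ν (fun x => g x μ) y) ^ 2
      = ∑ μ, ∑ ν, fdiff μ (fun x => g x ν) y ^ 2 + ∑ μ, ∑ ν, fdiff ν (fun x => g x μ) y ^ 2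
        - 2 * ∑ μ, ∑ ν, fdiff μ (fun x => g x ν) y * fdiff ν (fun x => g x μ) y := by
    intro y
    rw [Finset.mul_sum, ← Finset.sum_add_distrib, ← Finset.sum_sub_distrib]
    refine Finset.sum_congr rfl fun μ _ => ?_
    rw [Finset.mul_sum, ← Finset.sum_add_distrib, ← Finset.sum_sub_distrib]
    refine Finset.sum_congr rfl fun ν _ => ?_
    ring
  have h1 : ∑ y ∈ box z R, ∑ μ, ∑ ν, (fdiff μ (fun x => g x ν) y - fdiff ν (fun x => g x μ) y) ^ 2
      = ∑ y ∈ box z R, ∑ μ, ∑ ν, fdiff μ (fun x => g x ν) y ^ 2 + ∑ y ∈ box z R, ∑ μ, ∑ ν, fdiff ν (fun x => g x μ) y ^ 2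
        - 2 * ∑ y ∈ box z R, ∑ μ, ∑ ν, fdiff μ (fun x => g x ν) y * fdiff ν (fun x => g x μ) y := by
    rw [Finset.mul_sum, ← Finset.sum_add_distrib, ← Finset.sum_sub_distrib]
    exact Finset.sum_congr rfl fun y _ => hC y
  have h2 : ∑ y ∈ box z R, dvg g y ^ 2 = ∑ y ∈ box z R, ∑ μ, ∑ ν, (g (y - unitVec μ) μ - g y μ) * (g (y - unitVec ν) ν - g y ν) :=
    Finset.sum_congr rfl fun y _ => hD y
  rw [h1, h2, hG, ← hXY]
  ring

end Summit.QuantumFields.YangMills.Theorems.Prop7LatticeWeitzenbockZd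

end
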